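import Summits.BirchSwinnertonDyer.BirchSwinnertonDyer.Theorems.ByReductionTypeAtTwoOrdKatoHalfAtTwoIsoZetaColemanMuIotaTranspose
import Summits.BirchSwinnertonDyer.BirchSwinnertonDyer.Theorems.ByReductionTypeAtTwoOrdKatoHalfAtTwoIsoZetaColemanMuIotaChain
import Summits.BirchSwinnertonDyer.BirchSwinnertonDyer.Theorems.ByReductionTypeAtTwoOrdKatoHalfAtTwoIsoZetaColemanMuLocOnePlace
import HarnessLib

/-!
# Route ByReductionTypeAtTwo, crux `OrdKatoHalfAtTwoIso` (stmt-BirchSwinnertonDyer-19573), line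
# `steinberg-fibre-at-two`, child F1μ⁺ `OrdKatoFineZetaAtTwoResidue` (stmt-BirchSwinnertonDyer-23959): ASSEMBLY — from the
# HONEST inputs at `2` (a local Coleman dual pair keyed by the INVERSE `ψ⁻ = conj_{γᵥ}⁻¹ − 1`, `φ = loc₂` at ONE place above `2`,
# reciprocity on Kato's classes, the explicit reciprocity law in shape) to the `ι`-semilinear reading «F1μ⁺θ» at `θ = ι`, and
# on to `μ = 0`, B8, the residue binder and the CRUX BY NAME — no untwist inside the datum anywhere

Seat `cruxlead-stmt-BirchSwinnertonDyer-19573-w3` g2 (prover WIDTH under the LEAD `cruxlead-19573` g5; HOME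
`run/shared/lean/pub/bsd-2adic/`; `--supports` stmt-BirchSwinnertonDyer-23959). HONEST FRAMING (cell bsd-2adic): BSD is not
proved by any of this; F1μ⁺, CoreA⁺, B7 and the crux are NOT proved here; every theorem is a KERNEL implication over explicit
hypotheses (no definition, no named fact, no `sorry`). Capstone of this seat's files p688256 (`…SignFreeSupply`), p690240
(`…LocOnePlace`), p690167 (`…IotaDoor`), p691108 (`…IotaTranspose`), `…IotaChain`.

* §1 `zetaColemanMuTheta_invol_datum_of_localDualPair_locTwo_erl` / `…_locOne_erl` — per datum, the package of «F1μ⁺θ» at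
  the FIXED key `θ = ι = IwasawaAlgebra.involEquiv 2` (the shape `…IotaChain` consumes) from the honest (L′)(R)(E): `P := range col`,
  `ℓ := col ∘ ℓ₀`, `τ := F ∘ col⁻¹` with `F` the `ι`-semilinear transpose of `φ` (p691108 `exists_involSemilinear_transpose`), `π` the
  canonical fine quotient; `…_locOne_erl` takes `φ`'s kernel at ONE place above `2` (p690240).
* §2 `zetaColemanMuTheta_invol_of_honestLocalDualPairs` — the ∀-supply: honest (L′)(R)(E) for every `(W, D)` on the sign-free
  habitat ⇒ the `θ = ι` supply `hZθ` of `…IotaChain`; and BY NAME `ordKatoHalfAtTwoIso_of_honestLocalDualPairs` (the CRUX from the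
  honest supply + CoreA⁺ + Abbes–Ullmo + B7 + Kato 17.4 (1)(2)), `…_cite` (split-glue shape: bundle `PUB ∧ AU ∧ 5.14@2`, B7′),
  `mu_eq_zero_of_honestLocalDualPairs`. So the beyond-print content of the F1 child is, in the kernel, exactly the three typed
  inputs in their HONEST keying: F1-Col (injective `col` on `𝐇¹_loc/𝐇¹_loc(F⁺)`), F1-Dual+R (`IsDualPair 2 (conj_{γᵥ}⁻¹ − 1) ⟨·,·⟩`,
  `loc₂`, Poitou–Tate on Kato's classes), F1-ERLμ (16.6 (2) at `2` in shape) — and the text that matches them is «F1μ⁺ι».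

References: [Kato2004Asterisque] Thm 12.6 (p. 222), (14.9.3) (p. 240), Thm 16.6 (2) (p. 271), Thm 17.4 (1)(2) (p. 273),
Prop 17.11 (p. 277), §17.13 (pp. 279–280); [MilneADT2006] I Cor. 2.3; [GreenbergLNM1716] §1 p. 60, §2 Prop 2.1;
[MazurTateTeitelbaum1986Invent] §I.17; [AbbesUllmo1996] Thm A; tree p682177, p684479, p686000, p688256, p690167, p690240, p691108.
-/

set_option autoImplicit false
set_option linter.dupNamespace false

noncomputable section

open scoped Classical MatrixGroups ModularForm NumberField
open CongruenceSubgroup WeierstrassCurve Field IsDedekindDomain NumberField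
open Literature.NumberTheory.GaloisRepresentations
open Literature.NumberTheory.EllipticCurves Literature.NumberTheory.EllipticCurves.ModularForms
  Literature.NumberTheory.EllipticCurves.GreenbergSelmer
open Literature.NumberTheory.EllipticCurves.Kato2004
  Literature.NumberTheory.EllipticCurves.Kato2004.EulerSystemValues
open Literature.NumberTheory.EllipticCurves.IwasawaDual
open Literature.NumberTheory.EllipticCurves.Rank1Residual
open Literature.NumberTheory.EllipticCurves.Greenberg1999
open Summit.BirchSwinnertonDyer.Rank1Residual Summit.BirchSwinnertonDyer.Rank1Residual.X5
open Summit.BirchSwinnertonDyer.BirchSwinnertonDyer.Theorems.OrdKatoOptimalAtTwo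
  Summit.BirchSwinnertonDyer.BirchSwinnertonDyer.Theorems.OrdKatoIntAtTwo
open Summit.BirchSwinnertonDyer.BirchSwinnertonDyer.Theses.ByReductionTypeAtTwo

namespace Summit.BirchSwinnertonDyer.BirchSwinnertonDyer.Theorems.SteinbergFibreAtTwo

/-! ## §1 Per datum: «F1μ⁺θ» at the fixed key `θ = ι` from the honest inputs -/

section PerDatum

variable {W : WeierstrassCurve ℚ} [W.IsElliptic] [W.IsGloballyMinimal]
  [ContinuousSMul ℤ_[2] (W.tateModule 2)] [Module.Free ℤ_[2] (W.tateModule 2)]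
  [Module.Finite ℤ_[2] (W.tateModule 2)] {N : ℕ} {f : CuspForm (Gamma0 N) 2}
  {κ : ZpExtension ℚ 2} {γ : absoluteGaloisGroup ℚ} {hκ : κ.IsCyclotomic}

/-- **«F1μ⁺θ» at `θ = ι`, per datum, from the honest inputs** — the fixed-key form of p691108
`zetaColemanMuIota_datum_of_localDualPair_locTwo_erl` (same construction: `P := range col`, `ℓ := col ∘ ℓ₀`, `τ := F ∘ col⁻¹` with
`F` the `ι`-semilinear transpose of `φ = loc₂` against the dual pair keyed by `ψ⁻`, `π` the canonical fine quotient). Kernel;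
nothing asserted. [cite: Kato2004Asterisque, (14.9.3) (p. 240), Thm 16.6 (2) (p. 271), Prop 17.11 (p. 277), §17.13 (pp. 279–280)]
[cite: MilneADT2006, Ch. I, Cor. 2.3] -/
theorem zetaColemanMuTheta_invol_datum_of_localDualPair_locTwo_erl (D : W.SelmerDualData κ γ)
    (Y : W.FineSelmerDualData κ γ) (I : IwasawaH1Data W 2 κ γ) (G : Set I.H)
    (hG : ∀ g ∈ G, IsEulerSystemClassTwo W hκ I g)
    {P₀ : Type*} [AddCommGroup P₀] [Module (IwasawaAlgebra 2) P₀] {S : Type*} [AddCommGroup S]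
    {ψm : AddMonoid.End S} {toDualP : P₀ →+ (S →+ AddCircle (1 : ℚ))} (hP : IsDualPair 2 ψm toDualP)
    (ψ : AddMonoid.End S) (hψ₁ : (1 + ψm) * (1 + ψ) = 1) (hψ₂ : (1 + ψ) * (1 + ψm) = 1)
    (col : P₀ →ₗ[IwasawaAlgebra 2] IwasawaAlgebra 2) (hcol : Function.Injective col)
    (φ : W.selmerInfty κ →+ S) (hφ : ∀ s, φ ((W.conjSelmerInfty κ γ - 1) s) = ψ (φ s))
    (hφker : ∀ s : W.selmerInfty κ, φ s = 0 ↔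
      ∀ (v : HeightOneSpectrum (𝓞 ℚ)), ((2 : ℕ) : 𝓞 ℚ) ∈ v.asIdeal → ∀ σ : absoluteGaloisGroup ℚ,
        W.conjH1 2 κ.kerSubgroup σ (s : W.subgroupH1 2 κ.kerSubgroup) ∈
          awayKer κ.kerSubgroup (W.geomPrimaryTorsion 2) v)
    (ℓ₀ : I.H →ₗ[IwasawaAlgebra 2] P₀)
    (hrecG : ∀ g ∈ G, ∀ s : W.selmerInfty κ, toDualP (ℓ₀ g) (φ s) = 0)
    (herl : ∃ g ∈ G, ∃ (u : (IwasawaAlgebra 2)ˣ) (M L' : IwasawaAlgebra 2) (r : ℚ_[2]),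
      M ∉ IwasawaAlgebra.augIdealP 2 ∧ ‖r‖ = 1 ∧
        iwasawaToPowerSeries 2 L' = PowerSeries.C r * padicLFunction f (unitRoot W 2 : ℚ_[2]) ∧
        col (ℓ₀ g) = (u : IwasawaAlgebra 2) * M * L') :
    ∃ (Z : Submodule (IwasawaAlgebra 2) I.H) (P : Submodule (IwasawaAlgebra 2) (IwasawaAlgebra 2))
      (ℓ : I.H →ₗ[IwasawaAlgebra 2] P)
      (τ : P →ₛₗ[((IwasawaAlgebra.involEquiv 2).toRingEquiv : IwasawaAlgebra 2 →+* IwasawaAlgebra 2)] D.X)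
      (π : D.X →ₗ[IwasawaAlgebra 2] Y.X),
      Z ≤ Submodule.span (IwasawaAlgebra 2) {s : I.H | IsEulerSystemClassTwo W hκ I s} ∧
      (∀ z ∈ Z, τ (ℓ z) = 0) ∧ Function.Surjective π ∧ Function.Exact τ π ∧
      ∀ G₁ : IwasawaAlgebra 2,
        iwasawaToPowerSeries 2 G₁ = padicLFunction f (unitRoot W 2 : ℚ_[2]) →
          ∃ s : IwasawaAlgebra 2, s ∉ IwasawaAlgebra.augIdealP 2 ∧
            s * G₁ ∈ Submodule.map (P.subtype ∘ₗ ℓ) Z := by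
  obtain ⟨F, hF⟩ := exists_involSemilinear_transpose hP (D.isDualPair' W κ) ψ hψ₁ hψ₂ φ hφ
  obtain ⟨π, hπs, hπ⟩ := WeierstrassCurve.FineSelmerDualData.exists_linearMap_ofSelmerDual W κ D Y
  have hker' : ∀ s : W.selmerInfty κ,
      φ s = 0 ↔ s ∈ (AddSubgroup.inclusion (W.fineSelmerInfty_le_selmerInfty κ)).range := by
    intro s
    rw [hker_of_kernel_above_two φ hφker, AddMonoidHom.mem_range]
    constructor
    · intro hs
      exact ⟨⟨(s : W.subgroupH1 2 κ.kerSubgroup), hs⟩, Subtype.ext rfl⟩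
    · rintro ⟨s₀, rfl⟩
      exact s₀.2
  have hexact : Function.Exact F π :=
    exact_transpose_of_ker_eq_range D.bijective Y.bijective.1 hP.bijective.2
      (AddSubgroup.inclusion (W.fineSelmerInfty_le_selmerInfty κ)) φ hker' hπ hF
  have hZ0 : ∀ z ∈ Submodule.span (IwasawaAlgebra 2) G, F (ℓ₀ z) = 0 := by
    have hle : Submodule.span (IwasawaAlgebra 2) G ≤ (LinearMap.ker F).comap ℓ₀ := by
      rw [Submodule.span_le]
      intro g hg
      rw [SetLike.mem_coe, Submodule.mem_comap, LinearMap.mem_ker]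
      exact transpose_eq_zero_of_pairing_eq_zero D.bijective.1 φ hF (hrecG g hg)
    intro z hz
    have := hle hz
    rwa [Submodule.mem_comap, LinearMap.mem_ker] at this
  let e : P₀ ≃ₗ[IwasawaAlgebra 2] LinearMap.range col := LinearEquiv.ofInjective col hcol
  have he : ∀ x : P₀, e.symm (col.rangeRestrict x) = x := fun x => by
    rw [LinearEquiv.symm_apply_eq]
    ext
    simp [e, LinearEquiv.ofInjective_apply]
  refine ⟨Submodule.span (IwasawaAlgebra 2) G, LinearMap.range col, col.rangeRestrict ∘ₗ ℓ₀,
    F.comp e.symm.toLinearMap, π, Submodule.span_mono fun g hg => hG g hg, ?_, hπs, ?_, ?_⟩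
  · intro z hz
    change F (e.symm (col.rangeRestrict (ℓ₀ z))) = 0
    rw [he]
    exact hZ0 z hz
  · intro x
    refine (hexact x).trans ⟨?_, ?_⟩
    · rintro ⟨u, hu⟩
      exact ⟨e u, by change F (e.symm (e u)) = x; rw [LinearEquiv.symm_apply_apply]; exact hu⟩
    · rintro ⟨v, hv⟩
      exact ⟨e.symm v, hv⟩
  · intro G₁ hG₁
    obtain ⟨g, hg, s, hs, hsG⟩ := himgG_of_erlShape G col ℓ₀ herl G₁ hG₁
    refine ⟨s, hs, ⟨g, Submodule.subset_span hg, ?_⟩⟩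
    rw [← hsG]
    rfl

/-- **«F1μ⁺θ» at `θ = ι`, per datum, with `φ = loc₂` given by its kernel at ONE place above `2`** (p690240
`hφker_of_kernel_at_one_place_two`: `ℚ_∞/ℚ` is undecomposed at `2`). Kernel; nothing asserted.
[cite: Kato2004Asterisque, (14.9.3) (p. 240), Prop 17.11 (p. 277), §17.13 (pp. 279–280)] [cite: GreenbergLNM1716, §2 (p. 72)] -/
theorem zetaColemanMuTheta_invol_datum_of_localDualPair_locOne_erl (D : W.SelmerDualData κ γ)
    (Y : W.FineSelmerDualData κ γ) (I : IwasawaH1Data W 2 κ γ) (G : Set I.H)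
    (hG : ∀ g ∈ G, IsEulerSystemClassTwo W hκ I g)
    (v₂ : HeightOneSpectrum (𝓞 ℚ)) (hv₂ : ((2 : ℕ) : 𝓞 ℚ) ∈ v₂.asIdeal)
    {P₀ : Type*} [AddCommGroup P₀] [Module (IwasawaAlgebra 2) P₀] {S : Type*} [AddCommGroup S]
    {ψm : AddMonoid.End S} {toDualP : P₀ →+ (S →+ AddCircle (1 : ℚ))} (hP : IsDualPair 2 ψm toDualP)
    (ψ : AddMonoid.End S) (hψ₁ : (1 + ψm) * (1 + ψ) = 1) (hψ₂ : (1 + ψ) * (1 + ψm) = 1)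
    (col : P₀ →ₗ[IwasawaAlgebra 2] IwasawaAlgebra 2) (hcol : Function.Injective col)
    (φ : W.selmerInfty κ →+ S) (hφ : ∀ s, φ ((W.conjSelmerInfty κ γ - 1) s) = ψ (φ s))
    (hφ₁ : ∀ s : W.selmerInfty κ, φ s = 0 ↔
      W.resOfLe 2 (inf_le_left : κ.kerSubgroup ⊓ decomp v₂ ≤ κ.kerSubgroup)
        (s : W.subgroupH1 2 κ.kerSubgroup) = 0)
    (ℓ₀ : I.H →ₗ[IwasawaAlgebra 2] P₀)
    (hrecG : ∀ g ∈ G, ∀ s : W.selmerInfty κ, toDualP (ℓ₀ g) (φ s) = 0)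
    (herl : ∃ g ∈ G, ∃ (u : (IwasawaAlgebra 2)ˣ) (M L' : IwasawaAlgebra 2) (r : ℚ_[2]),
      M ∉ IwasawaAlgebra.augIdealP 2 ∧ ‖r‖ = 1 ∧
        iwasawaToPowerSeries 2 L' = PowerSeries.C r * padicLFunction f (unitRoot W 2 : ℚ_[2]) ∧
        col (ℓ₀ g) = (u : IwasawaAlgebra 2) * M * L') :
    ∃ (Z : Submodule (IwasawaAlgebra 2) I.H) (P : Submodule (IwasawaAlgebra 2) (IwasawaAlgebra 2))
      (ℓ : I.H →ₗ[IwasawaAlgebra 2] P)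
      (τ : P →ₛₗ[((IwasawaAlgebra.involEquiv 2).toRingEquiv : IwasawaAlgebra 2 →+* IwasawaAlgebra 2)] D.X)
      (π : D.X →ₗ[IwasawaAlgebra 2] Y.X),
      Z ≤ Submodule.span (IwasawaAlgebra 2) {s : I.H | IsEulerSystemClassTwo W hκ I s} ∧
      (∀ z ∈ Z, τ (ℓ z) = 0) ∧ Function.Surjective π ∧ Function.Exact τ π ∧
      ∀ G₁ : IwasawaAlgebra 2,
        iwasawaToPowerSeries 2 G₁ = padicLFunction f (unitRoot W 2 : ℚ_[2]) →
          ∃ s : IwasawaAlgebra 2, s ∉ IwasawaAlgebra.augIdealP 2 ∧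
            s * G₁ ∈ Submodule.map (P.subtype ∘ₗ ℓ) Z :=
  zetaColemanMuTheta_invol_datum_of_localDualPair_locTwo_erl D Y I G hG hP ψ hψ₁ hψ₂ col hcol φ hφ
    (hφker_of_kernel_at_one_place_two hκ v₂ hv₂ φ hφ₁) ℓ₀ hrecG herl

end PerDatum

/-! ## §2 The ∀-supply from the honest inputs, and the doors BY NAME -/

section Honest

/- The HONEST ∀-supply: for every `W` on the sign-free habitat «good ordinary at `2`, `ρ̄₂` onto», newform `f`, cyclotomic
`(κ, γ)` and Selmer dual datum `D` — the pinned `𝐇¹`, a set `G` of genuine `2`-adic classes, a place `v₂ ∋ 2`, (L′) a local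
Coleman dual pair at `2` KEYED BY `ψ⁻` with an inverse key `ψ`, injective `col`, `φ` intertwining `ψ` with kernel at `v₂`, (R) on `G`,
(E) the ERL shape. A hypothesis (the three typed inputs at `2`), not a definition. -/
variable (hhonest : ∀ (W : WeierstrassCurve ℚ) [W.IsElliptic] [W.IsGloballyMinimal]
    [ContinuousSMul ℤ_[2] (W.tateModule 2)] [Module.Free ℤ_[2] (W.tateModule 2)]
    [Module.Finite ℤ_[2] (W.tateModule 2)] {N : ℕ} [NeZero N] (f : CuspForm (Gamma0 N) 2)
    (κ : ZpExtension ℚ 2) (γ : absoluteGaloisGroup ℚ) (hκ : κ.IsCyclotomic),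
    IsOrdinaryAt W 2 → W.HasSurjectiveModNGaloisRep 2 →
    κ.IsTopGenerator γ → IsCyclotomicVariable 2 γ → IsNewformOf W f →
    ∀ (D : W.SelmerDualData κ γ),
      ∃ (I : IwasawaH1Data W 2 κ γ) (G : Set I.H)
        (v₂ : HeightOneSpectrum (𝓞 ℚ)) (_ : ((2 : ℕ) : 𝓞 ℚ) ∈ v₂.asIdeal)
        (P₀ : Type) (_ : AddCommGroup P₀) (_ : Module (IwasawaAlgebra 2) P₀)
        (S : Type) (_ : AddCommGroup S) (ψm ψ : AddMonoid.End S) (toDualP : P₀ →+ (S →+ AddCircle (1 : ℚ)))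
        (col : P₀ →ₗ[IwasawaAlgebra 2] IwasawaAlgebra 2) (φ : W.selmerInfty κ →+ S)
        (ℓ₀ : I.H →ₗ[IwasawaAlgebra 2] P₀),
        (∀ g ∈ G, IsEulerSystemClassTwo W hκ I g) ∧
        IsDualPair 2 ψm toDualP ∧ (1 + ψm) * (1 + ψ) = 1 ∧ (1 + ψ) * (1 + ψm) = 1 ∧
        Function.Injective col ∧
        (∀ s, φ ((W.conjSelmerInfty κ γ - 1) s) = ψ (φ s)) ∧
        (∀ s : W.selmerInfty κ, φ s = 0 ↔
          W.resOfLe 2 (inf_le_left : κ.kerSubgroup ⊓ decomp v₂ ≤ κ.kerSubgroup)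
            (s : W.subgroupH1 2 κ.kerSubgroup) = 0) ∧
        (∀ g ∈ G, ∀ s : W.selmerInfty κ, toDualP (ℓ₀ g) (φ s) = 0) ∧
        ∃ g ∈ G, ∃ (u : (IwasawaAlgebra 2)ˣ) (M L' : IwasawaAlgebra 2) (r : ℚ_[2]),
          M ∉ IwasawaAlgebra.augIdealP 2 ∧ ‖r‖ = 1 ∧
            iwasawaToPowerSeries 2 L' = PowerSeries.C r * padicLFunction f (unitRoot W 2 : ℚ_[2]) ∧
            col (ℓ₀ g) = (u : IwasawaAlgebra 2) * M * L')

include hhonest in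
/-- **The honest ∀-supply gives «F1μ⁺θ» at `θ = ι`** (the hypothesis `hZθ` of `…IotaChain` at
`θ = IwasawaAlgebra.involEquiv 2`). Kernel; the supply is the OPEN content, nothing asserted.
[cite: Kato2004Asterisque, Thm 12.6 (p. 222), (14.9.3) (p. 240), Thm 16.6 (2) (p. 271), Prop 17.11 (p. 277), §17.13 (pp. 279–280)]
[cite: MilneADT2006, Ch. I, Cor. 2.3] -/
theorem zetaColemanMuTheta_invol_of_honestLocalDualPairs :
    ∀ (W : WeierstrassCurve ℚ) [W.IsElliptic] [W.IsGloballyMinimal]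
      [ContinuousSMul ℤ_[2] (W.tateModule 2)] [Module.Free ℤ_[2] (W.tateModule 2)]
      [Module.Finite ℤ_[2] (W.tateModule 2)] {N : ℕ} [NeZero N] (f : CuspForm (Gamma0 N) 2)
      (κ : ZpExtension ℚ 2) (γ : absoluteGaloisGroup ℚ) (hκ : κ.IsCyclotomic),
      IsOrdinaryAt W 2 → W.HasSurjectiveModNGaloisRep 2 →
      κ.IsTopGenerator γ → IsCyclotomicVariable 2 γ → IsNewformOf W f →
      ∀ (D : W.SelmerDualData κ γ) (Y : W.FineSelmerDualData κ γ),
        ∃ (I : IwasawaH1Data W 2 κ γ)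
          (Z : Submodule (IwasawaAlgebra 2) I.H) (P : Submodule (IwasawaAlgebra 2) (IwasawaAlgebra 2))
          (ℓ : I.H →ₗ[IwasawaAlgebra 2] P)
          (τ : P →ₛₗ[((IwasawaAlgebra.involEquiv 2).toRingEquiv : IwasawaAlgebra 2 →+* IwasawaAlgebra 2)] D.X)
          (π : D.X →ₗ[IwasawaAlgebra 2] Y.X),
          Z ≤ Submodule.span (IwasawaAlgebra 2) {s : I.H | IsEulerSystemClassTwo W hκ I s} ∧
          (∀ z ∈ Z, τ (ℓ z) = 0) ∧ Function.Surjective π ∧ Function.Exact τ π ∧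
          ∀ G₁ : IwasawaAlgebra 2,
            iwasawaToPowerSeries 2 G₁ = padicLFunction f (unitRoot W 2 : ℚ_[2]) →
              ∃ s : IwasawaAlgebra 2, s ∉ IwasawaAlgebra.augIdealP 2 ∧
                s * G₁ ∈ Submodule.map (P.subtype ∘ₗ ℓ) Z := by
  intro W _ _ _ _ _ N _ f κ γ hκ hord h2 hγ hγ' hf D Y
  obtain ⟨I, G, v₂, hv₂, P₀, instP₀, instP₀', S, instS, ψm, ψ, toDualP, col, φ, ℓ₀, hG, hP, hψ₁, hψ₂, hcol, hφ, hφ₁,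
    hrecG, herl⟩ := hhonest W f κ γ hκ hord h2 hγ hγ' hf D
  obtain ⟨Z, P, ℓ, τ, π, h⟩ := zetaColemanMuTheta_invol_datum_of_localDualPair_locOne_erl D Y I G hG v₂ hv₂ hP ψ hψ₁ hψ₂
    col hcol φ hφ hφ₁ ℓ₀ hrecG herl
  exact ⟨I, Z, P, ℓ, τ, π, h⟩

include hhonest in
/-- **`μ(X(E/ℚ_∞)) = 0` on the sign-free habitat from the honest supply and CoreA⁺** (`…IotaChain` at `θ = ι`).
[cite: Kato2004Asterisque, §17.13 (pp. 279–280)] [cite: GreenbergLNM1716, Conj. 1.11 (p. 64) (shape)] -/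
theorem mu_eq_zero_of_honestLocalDualPairs (hpos : CoreTheoremAPosDiscTwo)
    (W : WeierstrassCurve ℚ) [W.IsElliptic] [W.IsGloballyMinimal]
    (hgo : GoodOrd W 2) (h2 : W.HasSurjectiveModNGaloisRep 2)
    {N : ℕ} [NeZero N] (f : CuspForm (Gamma0 N) 2) (hf : IsNewformOf W f)
    (κ : ZpExtension ℚ 2) (γ : absoluteGaloisGroup ℚ) (hκ : κ.IsCyclotomic) (hγ : κ.IsTopGenerator γ)
    (hγ' : IsCyclotomicVariable 2 γ) (D : W.SelmerDualData κ γ) : D.mu = 0 :=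
  mu_eq_zero_of_zetaColemanMuTheta (IwasawaAlgebra.involEquiv 2).toRingEquiv
    (zetaColemanMuTheta_invol_of_honestLocalDualPairs hhonest) hpos W hgo h2 f hf κ γ hκ hγ hγ' D

include hhonest in
/-- **The crux `OrdKatoHalfAtTwoIso` (stmt-BirchSwinnertonDyer-19573) BY NAME from the honest supply + CoreA⁺ + Abbes–Ullmo + B7 +
Kato 17.4 (1)(2) at `2`** (`…IotaChain` at `θ = ι`; B8 derived inside). CONDITIONAL; nothing closed.
[cite: Kato2004Asterisque, Thm. 17.4 (1)(2) (p. 273)] [cite: AbbesUllmo1996, Thm. A] -/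
theorem ordKatoHalfAtTwoIso_of_honestLocalDualPairs (hpos : CoreTheoremAPosDiscTwo)
    (hAU : abbesUllmo_not_dvd_maninConstant_of_not_dvd_level) (hB7 : KatoMuPartAtOptimalMemberOfNotSurjectiveTwo)
    (h17 : ∀ (V : WeierstrassCurve ℚ) [V.IsElliptic] [V.IsGloballyMinimal] [NeZero (V.conductorNorm ℤ)]
      (f : CuspForm (Gamma0 (V.conductorNorm ℤ)) 2), kato_divisibility_allPrimes V 2 (f := f)) :
    OrdKatoHalfAtTwoIso :=
  ordKatoHalfAtTwoIso_of_zetaColemanMuTheta (IwasawaAlgebra.involEquiv 2).toRingEquiv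
    (zetaColemanMuTheta_invol_of_honestLocalDualPairs hhonest) hpos hAU hB7 h17

include hhonest in
/-- **The crux BY NAME in the split glue's shape from the honest supply** — bundle `PUB ∧ AU ∧ 5.14@2` (child 23889), the
honest supply in the F1 slot, B7′ (child 23921), CoreA⁺. CONDITIONAL; nothing closed.
[cite: Kato2004Asterisque, Thm. 17.4 (1)(2) (p. 273)] [cite: GreenbergLNM1716, Prop. 5.14 (p. 130)] [cite: AbbesUllmo1996, Thm. A] -/
theorem ordKatoHalfAtTwoIso_of_honestLocalDualPairs_cite (hpos : CoreTheoremAPosDiscTwo)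
    (hbundle : OrdPublishedInputsAtTwo ∧ abbesUllmo_not_dvd_maninConstant_of_not_dvd_level ∧
      prop514_isTorsion_mu_eq_zero_two)
    (hB7' : KatoMuPartOff514AtOptimalMemberOfNotSurjectiveTwo) : OrdKatoHalfAtTwoIso :=
  ordKatoHalfAtTwoIso_of_zetaColemanMuTheta_cite (IwasawaAlgebra.involEquiv 2).toRingEquiv
    (zetaColemanMuTheta_invol_of_honestLocalDualPairs hhonest) hpos hbundle hB7'

end Honest

end Summit.BirchSwinnertonDyer.BirchSwinnertonDyer.Theorems.SteinbergFibreAtTwo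

end
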